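import Mathlib.Topology.Algebra.Group.Basic
import Mathlib.Topology.Algebra.Ring.Basic
import Mathlib.GroupTheory.GroupAction.ConjAct
import Mathlib.Algebra.Group.Subgroup.Pointwise
import Mathlib.NumberTheory.Padics.PadicIntegers
import Mathlib.NumberTheory.Padics.RingHoms

/-!
# Cross-estrangement of the two branch groups of `𝒢_θ` by abelianisation ([SemiAnbd] Def. 2.4 (iv))

S. Mochizuki, *Semi-graphs of anabelioids*, Publ. RIMS **42** (2006), Def. 2.4 (iv), author's manuscript
p. 26 l. 4–9 [cite: MochizukiSemiAnbd2006, Def 2.4(iv) p.26]: an edge `e` is *estranged* if «for every vertex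
`v` to which some branch `b` of `e` abuts and every `g ∈ Π_v`, the intersection in `Π_v` of `Π_b` with any
subgroup of the form `g · Π_{b′} · g⁻¹`, where either `b′ ≠ b` is a branch of an edge that abuts to `v` or
`b′ = b` and `g ∉ Π_b`, … is, in fact, trivial».

FRONTIER programme «REFUTE-F1732» (plan/L3/SUBDAG-SemiAnbd-Thm37iii-REFUTE.md), brick **R2b** («proved
halves»), seat abc-iut-w6-d096 — towards a kernel erratum for the ∀-countable reading of [SemiAnbd]
Thm 3.7 (iii) ([IUTchI] Rmk 2.5.3); desk countermodel by abc-iut-L3-d1 g3, memo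
`HOME/staging/L3/L3-d1/g3/COUNTERMODEL-Thm37iii-infinite.md` sha16 8b26b5199c29f55f; print proves finite `𝔾`
(kernel: p431007).  The countermodel `𝒢_θ` glues copies of the free pro-`p` group `G` of rank two
(generators `a`, `b`; brick R1) along `ℤ_p` via `1 ↦ a` and `1 ↦ a·b^{pⁿ}`; hypothesis (H3) of Thm 3.7
(`𝒢_θ` totally estranged) needs at each vertex, for the two branch groups `Π_b = Ā := closure⟨a⟩` and
`Π_{b′} = Ā_n := closure⟨a·b^{pⁿ}⟩`, the CROSS case `b′ ≠ b` of Def. 2.4 (iv): `Ā ∩ g·Ā_n·g⁻¹ = {1}` for every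
`g`.  THIS PROOF-ONLY FILE (no definitions, no named fact) proves that cross case from nothing more than a
continuous homomorphism `ab : G → R × R` to a Hausdorff topological ring without zero divisors (R1's continuous
abelianisation, `R = ℤ_[p]`) with `ab(a) = (1,0)`, `ab(a·b^{pⁿ}) = (1, pⁿ)` and `ab` injective on `Ā` — in BINDER
form over an arbitrary topological group `G`, so that bricks R1/R5 bind it with zero glue:

* `PadicInt.eq_zero_and_eq_zero_of_smul_eq_smul_pow` — the linear algebra «`λ·(1,0) = μ·(1,pⁿ)` ⇒ `λ = μ = 0`»
  (the abelianised intersection; `ℤ_[p]` is a domain and `pⁿ ≠ 0`);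
* `toAdd_map_snd_eq_mul_fst_of_mem_topologicalClosure_zpowers` — the image of `closure⟨c⟩` under `ab` lies on the
  CLOSED line `v₂ = d·v₁` through `ab(c) = (1,d)`;
* `inf_conj_topologicalClosure_zpowers_eq_bot_of_character` — **cross-ESTRANGEMENT**: `Ā_a ⊓ g • Ā_c = ⊥` for every
  `g : ConjAct G`, whenever `ab(a) = (1,0)`, `ab(c) = (1,d)` with `d ≠ 0` and `ab` is injective on `Ā_a` (the target
  is abelian, so `ab(g y g⁻¹) = ab(y)`; the two lines meet only in `0`);
* `inf_conj_topologicalClosure_zpowers_mul_pow_eq_bot` — the generator form `c = a·b^k`, `ab(b) = (0,1)`,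
  `(k : R) ≠ 0`; `PadicInt.inf_conj_topologicalClosure_zpowers_mul_pow_prime_pow_eq_bot` — the `ℤ_[p]` instance
  `k = pⁿ`, i.e. `Ā ⊓ g • Ā_n = ⊥`.

v2 (append): `PadicInt.eq_one_of_mem_topologicalClosure_zpowers_of_map_eq_one` DISCHARGES the binder
`hinj` from the `ℤ_p`-exponential `α` of `Ā` (`α(1) = a`, `Ā ≤ range α`; density of `ℤ` in `ℤ_p`), and
`PadicInt.inf_conj_topologicalClosure_zpowers_mul_pow_prime_pow_eq_bot_of_exponential` is the cross-estrangement
with no binder but R1/R1c's data (`ab`, `α`).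

The SELF case `b′ = b`, `g ∉ Π_b` (malnormality of `Ā`, `Ā_n`) and verticial slimness are brick R2a
(abc-iut-L3-t7: `IsProSigmaCompletion.closure_zpowers_inf_conj_eq_bot`, `…isSlimGroup`, already kernel
theorems for pro-`Σ` completions of free groups).  Vocabulary as in `Literature/GroupTheory/ProcyclicClosedSubgroups.lean`
(`(Subgroup.zpowers a).topologicalClosure`, conjugates via `ConjAct`).  Mathlib-only; nothing here bears on
[IUTchIII] Cor. 3.12 or asserts anything about abc; no side taken.
-/

open scoped Pointwise

namespace Literature.AnabelianGeometry.SemiGraphs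

namespace FreeProPTwo

/-! ### The linear algebra: two lines through the origin meet only in the origin -/

/-- **«`λ·(1,0) = μ·(1,d)` with `d ≠ 0` forces `λ = μ = 0`»**, written without scalars: in a ring without
zero divisors, `(l, 0) = (m, m·d)` with `d ≠ 0` implies `l = 0` and `m = 0` — the abelianised form of the cross case of
[SemiAnbd] Def. 2.4 (iv). [cite: MochizukiSemiAnbd2006, Def 2.4(iv) p.26] -/
theorem eq_zero_and_eq_zero_of_pair_eq {R : Type*} [Ring R] [NoZeroDivisors R] {d : R} (hd : d ≠ 0)
    {l m : R} (h : ((l, 0) : R × R) = (m, m * d)) : l = 0 ∧ m = 0 := by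
  have h1 : l = m := congrArg Prod.fst h
  have h2 : (0 : R) = m * d := congrArg Prod.snd h
  have hm : m = 0 := by
    rcases mul_eq_zero.mp h2.symm with hm | hd'
    · exact hm
    · exact absurd hd' hd
  exact ⟨h1.trans hm, hm⟩

/-- A point lying on both lines `v₂ = 0` and `v₂ = d·v₁` (`d ≠ 0`, no zero divisors) is the origin.
[cite: MochizukiSemiAnbd2006, Def 2.4(iv) p.26] -/
theorem pair_eq_zero_of_snd_eq_zero_of_snd_eq_mul {R : Type*} [Ring R] [NoZeroDivisors R] {d : R}
    (hd : d ≠ 0) {v : R × R} (h0 : v.2 = 0) (hl : v.2 = d * v.1) : v = 0 := by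
  have h1 : v.1 = 0 := by
    rcases mul_eq_zero.mp (hl.symm.trans h0) with hd' | h1
    · exact absurd hd' hd
    · exact h1
  exact Prod.ext h1 h0

/-- **The `ℤ_[p]` instance**: `λ•(1,0) = μ•(1,pⁿ)` in `ℤ_[p] × ℤ_[p]` forces `λ = 0` and `μ = 0`
(`ℤ_[p]` is a domain and `pⁿ ≠ 0`) — the abelianisation of `Ā ∩ g·Ā_n·g⁻¹` in `G^{ab} = ℤ_p²`. [cite: MochizukiSemiAnbd2006, Def 2.4(iv) p.26] -/
theorem PadicInt.eq_zero_and_eq_zero_of_smul_eq_smul_pow (p : ℕ) [Fact p.Prime] (n : ℕ) {l m : ℤ_[p]}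
    (h : l • ((1 : ℤ_[p]), (0 : ℤ_[p])) = m • ((1 : ℤ_[p]), (p : ℤ_[p]) ^ n)) : l = 0 ∧ m = 0 := by
  have hp : ((p : ℤ_[p]) ^ n) ≠ 0 := pow_ne_zero _ (Nat.cast_ne_zero.mpr (Fact.out : p.Prime).ne_zero)
  refine eq_zero_and_eq_zero_of_pair_eq hp ?_
  simpa [Prod.smul_mk, smul_eq_mul] using h

/-! ### The image of a pro-cyclic closed subgroup under a continuous character lies on a closed line -/

section Line

variable {R : Type*} [CommRing R]

/-- The additive homomorphism `v ↦ v₂ − d·v₁` on `R × R`, whose kernel is the line `v₂ = d·v₁` (plumbing). [cite: MochizukiSemiAnbd2006, Def 2.4(iv) p.26] -/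
theorem lineHom_apply (d : R) (v : R × R) :
    ((AddMonoidHom.snd R R) - (AddMonoidHom.mulLeft d).comp (AddMonoidHom.fst R R)) v = v.2 - d * v.1 := rfl

/-- Membership in the kernel of `v ↦ v₂ − d·v₁` is the line equation `v₂ = d·v₁` (plumbing). [cite: MochizukiSemiAnbd2006, Def 2.4(iv) p.26] -/
theorem mem_ker_lineHom_iff (d : R) (v : R × R) :
    v ∈ ((AddMonoidHom.snd R R) - (AddMonoidHom.mulLeft d).comp (AddMonoidHom.fst R R)).ker ↔ v.2 = d * v.1 := by
  rw [AddMonoidHom.mem_ker, lineHom_apply, sub_eq_zero]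

/-- The line `v₂ = d·v₁` is closed in a Hausdorff topological ring (plumbing). [cite: MochizukiSemiAnbd2006, Def 2.4(iv) p.26] -/
theorem isClosed_ker_lineHom [TopologicalSpace R] [IsTopologicalRing R] [T2Space R] (d : R) :
    IsClosed ((((AddMonoidHom.snd R R) - (AddMonoidHom.mulLeft d).comp (AddMonoidHom.fst R R)).ker :
      AddSubgroup (R × R)) : Set (R × R)) := by
  have h : ((((AddMonoidHom.snd R R) - (AddMonoidHom.mulLeft d).comp (AddMonoidHom.fst R R)).ker :
      AddSubgroup (R × R)) : Set (R × R)) = {v : R × R | v.2 = d * v.1} := by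
    ext v
    exact mem_ker_lineHom_iff d v
  rw [h]
  exact isClosed_eq continuous_snd (continuous_const.mul continuous_fst)

variable {G : Type*} [Group G]

/-- A homomorphism to an abelian group is constant on conjugacy classes: `ab(g • y) = ab(y)` for
`g : ConjAct G` — why Def. 2.4 (iv)'s conjugates `g·Π_{b′}·g⁻¹` are invisible to an abelian quotient. [cite: MochizukiSemiAnbd2006, Def 2.4(iv) p.26] -/
theorem map_conjAct_smul_eq {M : Type*} [CommGroup M] (f : G →* M) (g : ConjAct G) (y : G) :
    f (g • y) = f y := by
  rw [ConjAct.smul_def, map_mul, map_mul, map_inv, mul_comm (f (ConjAct.ofConjAct g)) (f y), mul_assoc,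
    mul_inv_cancel, mul_one]

end Line

section Character

variable {G : Type*} [Group G] [TopologicalSpace G] [IsTopologicalGroup G]
variable {R : Type*} [CommRing R] [TopologicalSpace R] [IsTopologicalRing R] [T2Space R]

/-- **The image of `closure⟨c⟩` under a continuous homomorphism `ab : G → R × R` with `ab(c) = (1, d)` lies
on the closed line `v₂ = d·v₁`.** (The powers of `c` map to `(k, k·d)`; the line is a closed subgroup and
`ab` is continuous.) [cite: MochizukiSemiAnbd2006, Def 2.4(iv) p.26] -/
theorem toAdd_map_snd_eq_mul_fst_of_mem_topologicalClosure_zpowers (ab : G →* Multiplicative (R × R))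
    (hab : Continuous ab) {c : G} {d : R} (hc : (ab c).toAdd = (1, d)) {x : G}
    (hx : x ∈ (Subgroup.zpowers c).topologicalClosure) : ((ab x).toAdd).2 = d * ((ab x).toAdd).1 := by
  -- the pull-back along `ab` of the line `v₂ = d·v₁`: a closed subgroup of `G` containing `c`
  let K : Subgroup G :=
    (((AddMonoidHom.snd R R) - (AddMonoidHom.mulLeft d).comp (AddMonoidHom.fst R R)).ker.toSubgroup).comap ab
  have hmem : ∀ y : G, y ∈ K ↔ ((ab y).toAdd).2 = d * ((ab y).toAdd).1 := fun y =>
    mem_ker_lineHom_iff d ((ab y).toAdd)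
  have hle : Subgroup.zpowers c ≤ K := by
    rw [Subgroup.zpowers_le, hmem, hc]
    simp
  have hK : IsClosed ((K : Subgroup G) : Set G) := by
    have h : ((K : Subgroup G) : Set G) = (fun y => (ab y).toAdd) ⁻¹'
        ((((AddMonoidHom.snd R R) - (AddMonoidHom.mulLeft d).comp (AddMonoidHom.fst R R)).ker :
          AddSubgroup (R × R)) : Set (R × R)) := rfl
    rw [h]
    exact (isClosed_ker_lineHom d).preimage (continuous_toAdd.comp hab)
  exact (hmem x).mp (Subgroup.topologicalClosure_minimal _ hle hK hx)

/-- In particular for `d = 0`: the image of `closure⟨a⟩` with `ab(a) = (1, 0)` lies on the axis `v₂ = 0`.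
[cite: MochizukiSemiAnbd2006, Def 2.4(iv) p.26] -/
theorem toAdd_map_snd_eq_zero_of_mem_topologicalClosure_zpowers (ab : G →* Multiplicative (R × R))
    (hab : Continuous ab) {a : G} (ha : (ab a).toAdd = (1, 0)) {x : G}
    (hx : x ∈ (Subgroup.zpowers a).topologicalClosure) : ((ab x).toAdd).2 = 0 := by
  simpa using toAdd_map_snd_eq_mul_fst_of_mem_topologicalClosure_zpowers ab hab ha hx

/-! ### Estrangement -/

/-- **ESTRANGEMENT by abelianisation.**  Let `ab : G → R × R` be a continuous homomorphism (`R` a Hausdorff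
topological ring without zero divisors) with `ab(a) = (1,0)` and `ab(c) = (1,d)`, `d ≠ 0`, injective on the
pro-cyclic closed subgroup `Ā_a = closure⟨a⟩`.  Then `Ā_a ∩ g·closure⟨c⟩·g⁻¹ = {1}` for EVERY `g`: an element of
the intersection maps under `ab` to a point of the line `v₂ = 0` (from `Ā_a`) AND of the line `v₂ = d·v₁`
(conjugation does not change `ab`), hence to `0`; injectivity on `Ā_a` finishes.  (For the free pro-`p` group
of rank two, `c = a·b^{pⁿ}`: «`λ(1,0) = μ(1,pⁿ)` ⇒ `λ = μ = 0`».)  This is the CROSS case `b′ ≠ b` of [SemiAnbd] Def. 2.4 (iv)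
«estranged» for a vertex group carrying such a character. [cite: MochizukiSemiAnbd2006, Def 2.4(iv) p.26] -/
theorem inf_conj_topologicalClosure_zpowers_eq_bot_of_character [NoZeroDivisors R]
    (ab : G →* Multiplicative (R × R)) (hab : Continuous ab) {a c : G} {d : R} (hd : d ≠ 0)
    (ha : (ab a).toAdd = (1, 0)) (hc : (ab c).toAdd = (1, d))
    (hinj : ∀ x ∈ (Subgroup.zpowers a).topologicalClosure, ab x = 1 → x = 1) (g : ConjAct G) :
    (Subgroup.zpowers a).topologicalClosure ⊓ g • (Subgroup.zpowers c).topologicalClosure = ⊥ := by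
  rw [eq_bot_iff]
  intro x hx
  rw [Subgroup.mem_inf] at hx
  obtain ⟨hxa, hxc⟩ := hx
  obtain ⟨y, hy, rfl⟩ := Subgroup.mem_smul_pointwise_iff_exists x g _ |>.mp hxc
  rw [Subgroup.mem_bot]
  refine hinj _ hxa ?_
  have h0 : ((ab (g • y)).toAdd).2 = 0 :=
    toAdd_map_snd_eq_zero_of_mem_topologicalClosure_zpowers ab hab ha hxa
  have hl : ((ab (g • y)).toAdd).2 = d * ((ab (g • y)).toAdd).1 := by
    rw [map_conjAct_smul_eq]
    exact toAdd_map_snd_eq_mul_fst_of_mem_topologicalClosure_zpowers ab hab hc hy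
  have hv : (ab (g • y)).toAdd = 0 := pair_eq_zero_of_snd_eq_zero_of_snd_eq_mul hd h0 hl
  exact toAdd_eq_zero.mp hv

/-- **Generator form**: with `ab(a) = (1,0)`, `ab(b) = (0,1)` and `k : ℕ` whose image in `R` is non-zero,
`closure⟨a⟩ ∩ g·closure⟨a·b^k⟩·g⁻¹ = {1}` for every `g`, given injectivity of `ab` on `closure⟨a⟩`. [cite: MochizukiSemiAnbd2006, Def 2.4(iv) p.26] -/
theorem inf_conj_topologicalClosure_zpowers_mul_pow_eq_bot [NoZeroDivisors R]
    (ab : G →* Multiplicative (R × R)) (hab : Continuous ab) {a b : G}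
    (ha : (ab a).toAdd = (1, 0)) (hb : (ab b).toAdd = (0, 1)) {k : ℕ} (hk : (k : R) ≠ 0)
    (hinj : ∀ x ∈ (Subgroup.zpowers a).topologicalClosure, ab x = 1 → x = 1) (g : ConjAct G) :
    (Subgroup.zpowers a).topologicalClosure ⊓ g • (Subgroup.zpowers (a * b ^ k)).topologicalClosure = ⊥ := by
  refine inf_conj_topologicalClosure_zpowers_eq_bot_of_character ab hab hk ha ?_ hinj g
  rw [map_mul, map_pow, toAdd_mul, toAdd_pow, ha, hb, Prod.smul_mk, Prod.mk_add_mk]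
  simp

end Character

/-- **The `ℤ_[p]` instance for the free pro-`p` group of rank two (brick R1's SHAPES in binder form)**: for a
topological group `G` with a continuous homomorphism `ab : G → ℤ_[p] × ℤ_[p]`, elements `a`, `b` with
`ab(a) = (1,0)`, `ab(b) = (0,1)`, and `ab` injective on `Ā = closure⟨a⟩` (there `Ā ≅ ℤ_p` via the first
coordinate), the closed pro-cyclic subgroups `Ā` and `Ā_n = closure⟨a·b^{pⁿ}⟩` are ESTRANGED:
`Ā ∩ g·Ā_n·g⁻¹ = {1}` for every `g ∈ G` — the cross case of Def. 2.4 (iv) at each vertex of `𝒢_θ` (hypothesis (H3) of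
Thm 3.7). [cite: MochizukiSemiAnbd2006, Def 2.4(iv) p.26] -/
theorem PadicInt.inf_conj_topologicalClosure_zpowers_mul_pow_prime_pow_eq_bot (p : ℕ) [Fact p.Prime]
    {G : Type*} [Group G] [TopologicalSpace G] [IsTopologicalGroup G]
    (ab : G →* Multiplicative (ℤ_[p] × ℤ_[p])) (hab : Continuous ab) {a b : G}
    (ha : (ab a).toAdd = (1, 0)) (hb : (ab b).toAdd = (0, 1)) (n : ℕ)
    (hinj : ∀ x ∈ (Subgroup.zpowers a).topologicalClosure, ab x = 1 → x = 1) (g : ConjAct G) :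
    (Subgroup.zpowers a).topologicalClosure ⊓
        g • (Subgroup.zpowers (a * b ^ (p ^ n))).topologicalClosure = ⊥ := by
  refine inf_conj_topologicalClosure_zpowers_mul_pow_eq_bot ab hab ha hb ?_ hinj g
  rw [Nat.cast_pow]
  exact pow_ne_zero _ (Nat.cast_ne_zero.mpr (Fact.out : p.Prime).ne_zero)

/-! ### v2 (append): the binder `hinj` from the `ℤ_p`-exponential of `Ā` -/

/-- **The binder `hinj` DISCHARGED from the `ℤ_p`-exponential of `Ā`** (brick R1c / abc-iut-L3-t7's bridge
`α.range = closure⟨a⟩`): if a continuous homomorphism `α : ℤ_p → G` (written multiplicatively) has `α(1) = a`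
and its range contains `Ā = closure⟨a⟩`, and `ab : G → ℤ_p × ℤ_p` is continuous with `ab(a) = (1,0)`, then
`ab` is injective on `Ā` in the form the estrangement theorem consumes: `x ∈ Ā`, `ab x = 1 ⇒ x = 1`.
(By density of `ℤ` in `ℤ_p` and continuity, `ab(α(z)) = (z, 0)` for every `z ∈ ℤ_p`.)  This is the last
input of the CROSS case of [SemiAnbd] Def. 2.4 (iv) for `𝒢_θ`'s branch groups.
[cite: MochizukiSemiAnbd2006, Def 2.4(iv) p.26] -/
theorem PadicInt.eq_one_of_mem_topologicalClosure_zpowers_of_map_eq_one (p : ℕ) [Fact p.Prime]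
    {G : Type*} [Group G] [TopologicalSpace G] [IsTopologicalGroup G]
    (ab : G →* Multiplicative (ℤ_[p] × ℤ_[p])) (hab : Continuous ab) {a : G}
    (ha : (ab a).toAdd = (1, 0)) (α : Multiplicative ℤ_[p] →* G) (hα : Continuous α)
    (hαa : α (Multiplicative.ofAdd 1) = a)
    (hrange : (Subgroup.zpowers a).topologicalClosure ≤ α.range) :
    ∀ x ∈ (Subgroup.zpowers a).topologicalClosure, ab x = 1 → x = 1 := by
  -- `ab ∘ α` has first coordinate the identity: true on `ℤ` (powers of `a`), hence on `ℤ_p` by density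
  have key : (fun z : ℤ_[p] => ((ab (α (Multiplicative.ofAdd z))).toAdd).1) = id := by
    refine PadicInt.denseRange_intCast.equalizer ?_ continuous_id ?_
    · exact continuous_fst.comp (continuous_toAdd.comp (hab.comp (hα.comp continuous_ofAdd)))
    · funext n
      simp only [Function.comp_apply, id]
      have h1 : Multiplicative.ofAdd ((n : ℤ) : ℤ_[p]) = Multiplicative.ofAdd (1 : ℤ_[p]) ^ (n : ℤ) := by
        rw [← ofAdd_zsmul, zsmul_one]
      rw [h1, map_zpow, hαa, map_zpow, toAdd_zpow, ha, Prod.smul_mk, zsmul_one, smul_zero]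
  intro x hx h1
  obtain ⟨y, rfl⟩ := hrange hx
  have hz : ((ab (α (Multiplicative.ofAdd (Multiplicative.toAdd y)))).toAdd).1 = Multiplicative.toAdd y :=
    congrFun key (Multiplicative.toAdd y)
  rw [ofAdd_toAdd, h1, toAdd_one, Prod.fst_zero] at hz
  have hy : y = 1 := by rw [← ofAdd_toAdd y, ← hz, ofAdd_zero]
  rw [hy, map_one]

/-- **Cross-ESTRANGEMENT for the free pro-`p` group of rank two with `hinj` discharged**: given R1's continuous
abelianisation `ab` (`ab a = (1,0)`, `ab b = (0,1)`) and the `ℤ_p`-exponential `α` of `Ā` (`α(1) = a`,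
`Ā ≤ range α`), `Ā ⊓ g • Ā_n = ⊥` for every `g : ConjAct G` and every `n` — [SemiAnbd] Def. 2.4 (iv), cross
case, at each vertex of `𝒢_θ`, with no binder left but R1/R1c's data. [cite: MochizukiSemiAnbd2006, Def 2.4(iv) p.26] -/
theorem PadicInt.inf_conj_topologicalClosure_zpowers_mul_pow_prime_pow_eq_bot_of_exponential (p : ℕ)
    [Fact p.Prime] {G : Type*} [Group G] [TopologicalSpace G] [IsTopologicalGroup G]
    (ab : G →* Multiplicative (ℤ_[p] × ℤ_[p])) (hab : Continuous ab) {a b : G}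
    (ha : (ab a).toAdd = (1, 0)) (hb : (ab b).toAdd = (0, 1)) (α : Multiplicative ℤ_[p] →* G)
    (hα : Continuous α) (hαa : α (Multiplicative.ofAdd 1) = a)
    (hrange : (Subgroup.zpowers a).topologicalClosure ≤ α.range) (n : ℕ) (g : ConjAct G) :
    (Subgroup.zpowers a).topologicalClosure ⊓
        g • (Subgroup.zpowers (a * b ^ (p ^ n))).topologicalClosure = ⊥ :=
  PadicInt.inf_conj_topologicalClosure_zpowers_mul_pow_prime_pow_eq_bot p ab hab ha hb n
    (PadicInt.eq_one_of_mem_topologicalClosure_zpowers_of_map_eq_one p ab hab ha α hα hαa hrange) g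

end FreeProPTwo

end Literature.AnabelianGeometry.SemiGraphs
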